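import Summits.BirchSwinnertonDyer.BirchSwinnertonDyer.Theorems.ManinLocalTwoThreeNegOneTwistConductorAtTwoWild
import Literature.NumberTheory.EllipticCurves.SzpiroLocalDataProofs
import Literature.NumberTheory.EllipticCurves.QuadraticTwistIntegralModel
import Literature.NumberTheory.EllipticCurves.QuadraticTwistMinimalModelProofs
import Literature.NumberTheory.EllipticCurves.RootNumberSmulProofs
import Literature.NumberTheory.EllipticCurves.BarriosEtAl2025.QuadraticTwistAtTwoConductorProofs
import HarnessLib

/-!
# S-an-58 / S-an-60 for EVERY `d ≡ 3 (mod 4)`, in the tree's Barrios shape: `f₂(W) = 2 ⟹ f₂(W ⊗ d) = 4`, `f₂(W) = 3 ⟹ f₂(W ⊗ d) = 4`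
# (route `ManinLocalTwoThree`, crux C2 `ManinOddAtFour` stmt-BirchSwinnertonDyer-22967; an g32 All.lean §11 nodes S-an-58L
# `conductorExponent_quadraticTwist_two_of_eq_two` / S-an-60L `…_of_eq_three`, companions of the tree's Barrios fact
# `BarriosEtAl2025.conductorExponent_quadraticTwist_two_of_le_one`; cell bsd-f2-manin, p2 gen 13)

Reduction to `d = −1` (this seat's `conductorExponent_quadraticTwist_negOne_eq_four_of_eq_two'/_three'`): for `d ≡ 3 (mod 4)` put `d′ = −d ≡ 1
(mod 4)`; the tree's twist model gives LITERALLY `(W ⊗ d′) ⊗ (−1) = W ⊗ d` (§1, `quadraticTwist_quadraticTwist_negOne`), and the twist by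
`d′ = 4k + 1` (`k ∈ ℤ`) is unramified at `2`, so `f₂(W ⊗ d′) = f₂(W)` (§1, `conductorExponent_twistModel` with `|k|₂ ≤ 1`, `|d′|₂ = 1`).
§2 states the two results with an's def bodies verbatim (`∀ W v, natGenerator v = 2 → f_v = 2 (resp. 3) → ∀ d, d % 4 = 3 → f_v(W ⊗ d) = 4`),
so that the nodes, once typed, are discharged by `fun W _ v hv hf d hd ↦ …`.

HONEST FRAMING: Barrios et al. 2025 Thm. 5.1, `v(d) = 0`, `d ≡ 3 (mod 4)`, rows IV/IV*/III/I₁*/III*/II*, column `(f, f^d)`, kernel-checked.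
Nothing about BSD or Manin's conjecture is proved; C2 OPEN. [cite: BarriosEtAl2025, Thm. 5.1 (arXiv:2501.03209 pp. 15–16)]
[cite: SilvermanAEC2009, X.2 Prop. 2.4 and X.5 Cor. 5.4] [cite: SilvermanATAEC1994, IV.9.4]
-/

set_option autoImplicit false
-- lint-debt: the directory name repeats the summit name (sibling precedent `ManinLocalTwoThreeNegOneTwistConductorAtTwo.lean`)
set_option linter.dupNamespace false

noncomputable section

open scoped Classical
open WeierstrassCurve IsDedekindDomain IsDedekindDomain.HeightOneSpectrum Rat.HeightOneSpectrum
  Literature.NumberTheory.DiophantineGeometry Literature.NumberTheory.EllipticCurves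

namespace Summit.BirchSwinnertonDyer.BirchSwinnertonDyer.Theorems.ManinLocalTwoThree

/-! ## §1 Twisting by `d′` and then by `−1` is twisting by `−d′`; the twist by `d′ ≡ 1 (mod 4)` does not move `f₂` -/

/-- **`(W ⊗ d′) ⊗ (−1) = W ⊗ (−d′)` on the nose** for the tree's twist model `[0, d b₂/4, 0, d² b₄/2, d³ b₆/4]`.
[cite: SilvermanAEC2009, X.2 Prop. 2.4] -/
theorem quadraticTwist_quadraticTwist_negOne (W : WeierstrassCurve ℚ) (d' : ℚ) :
    (W.quadraticTwist d').quadraticTwist (-1) = W.quadraticTwist (-d') := by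
  ext <;> simp [WeierstrassCurve.quadraticTwist, WeierstrassCurve.b₂, WeierstrassCurve.b₄, WeierstrassCurve.b₆] <;> ring

/-- **The twist by `d′ ≡ 1 (mod 4)` does not move the conductor exponent at `2`**: `d′ = 4k + 1` with `k ∈ ℤ`, so `W ⊗ d′ ≅ W.twistModel k`
(`exists_variableChange_twistModel_eq_quadraticTwist`) with `|k|₂ ≤ 1`, `|d′|₂ = 1` (`d′` odd), and `conductorExponent_twistModel` applies.
[cite: SilvermanATAEC1994, IV.9.4] -/
theorem conductorExponent_quadraticTwist_eq_of_emod_four_eq_one_two (W : WeierstrassCurve ℚ) [W.IsElliptic]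
    (v : HeightOneSpectrum ℤ) (hv : natGenerator v = 2) {d' : ℤ} (hd' : d' % 4 = 1) :
    (W.quadraticTwist (d' : ℚ)).conductorExponent v = W.conductorExponent v := by
  have hd0 : (d' : ℚ) ≠ 0 := by exact_mod_cast (show d' ≠ 0 by omega)
  -- `|d′|_v = 1`
  have hdv : v.valuation ℚ (d' : ℚ) = 1 := by
    rw [Literature.NumberTheory.EllipticCurves.Rat.valuation_intCast_eq_one_iff, hv]
    intro h
    have : (2 : ℤ) ∣ d' := by exact_mod_cast h
    omega
  set k : ℚ := ((d' : ℚ) - 1) / 4 with hk_def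
  have hk4 : 4 * k + 1 = (d' : ℚ) := by rw [hk_def]; ring
  have hkZ : k = (((d' - 1) / 4 : ℤ) : ℚ) := by
    have h4 : (4 : ℤ) ∣ d' - 1 := by omega
    rw [hk_def, Int.cast_div h4 (by norm_num)]
    push_cast
    ring
  have hkv : v.valuation ℚ k ≤ 1 := by
    rw [hkZ, show (((d' - 1) / 4 : ℤ) : ℚ) = algebraMap ℤ ℚ ((d' - 1) / 4) by rw [eq_intCast]]
    exact HeightOneSpectrum.valuation_le_one v _
  have hk1 : v.valuation ℚ (4 * k + 1) = 1 := by rw [hk4]; exact hdv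
  obtain ⟨C₁, -, hC₁⟩ := exists_variableChange_twistModel_eq_quadraticTwist W k
  rw [hk4] at hC₁
  haveI : (W.twistModel k).IsElliptic := by
    refine ⟨?_⟩
    rw [twistModel_Δ, hk4]
    exact (IsUnit.mk0 _ (pow_ne_zero 6 hd0)).mul W.isUnit_Δ
  haveI : (W.quadraticTwist (d' : ℚ)).IsElliptic := W.isElliptic_quadraticTwist hd0
  rw [← hC₁, conductorExponent_smul']
  exact conductorExponent_twistModel v W hkv hk1

/-- The reduction step: for `d ≡ 3 (mod 4)`, `W ⊗ d = (W ⊗ (−d)) ⊗ (−1)` with `−d ≡ 1 (mod 4)` and `f₂(W ⊗ (−d)) = f₂(W)`. [folklore] -/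
theorem conductorExponent_quadraticTwist_of_emod_four_eq_three_two (W : WeierstrassCurve ℚ) [W.IsElliptic]
    (v : HeightOneSpectrum ℤ) (hv : natGenerator v = 2) {d : ℤ} (hd : d % 4 = 3)
    (P : ℕ → Prop) (hP : ∀ (V : WeierstrassCurve ℚ) [V.IsElliptic], V.conductorExponent v = W.conductorExponent v →
      P ((V.quadraticTwist ((-1 : ℤ) : ℚ)).conductorExponent v)) :
    P ((W.quadraticTwist (d : ℚ)).conductorExponent v) := by
  have hd'0 : ((-d : ℤ) : ℚ) ≠ 0 := by exact_mod_cast (show -d ≠ 0 by omega)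
  haveI := W.isElliptic_quadraticTwist hd'0
  have hmod : (-d) % 4 = 1 := by omega
  have heq : (W.quadraticTwist ((-d : ℤ) : ℚ)).quadraticTwist ((-1 : ℤ) : ℚ) = W.quadraticTwist (d : ℚ) := by
    rw [show ((-1 : ℤ) : ℚ) = -1 by norm_num, quadraticTwist_quadraticTwist_negOne]
    push_cast
    rw [neg_neg]
  rw [← heq]
  exact hP _ (conductorExponent_quadraticTwist_eq_of_emod_four_eq_one_two W v hv hmod)

/-! ## §2 The Barrios-shape statements (an's S-an-58L / S-an-60L def bodies verbatim) -/

/-- **S-an-58L (an All.lean §11 `conductorExponent_quadraticTwist_two_of_eq_two`), PROVED**: `f_v(W) = 2` at the place above `2`, `d ≡ 3 (mod 4)`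
⟹ `f_v(W ⊗ d) = 4`. [cite: BarriosEtAl2025, Thm. 5.1, Table localdata-dodd rows IV, IV*, d ≡ 3 (mod 4)] -/
theorem conductorExponent_quadraticTwist_eq_four_of_eq_two_of_emod_four_eq_three :
    ∀ (W : WeierstrassCurve ℚ) [W.IsElliptic] (v : IsDedekindDomain.HeightOneSpectrum ℤ),
      Rat.HeightOneSpectrum.natGenerator v = 2 → W.conductorExponent v = 2 → ∀ d : ℤ,
        d % 4 = 3 → (W.quadraticTwist (d : ℚ)).conductorExponent v = 4 := by
  intro W _ v hv hf d hd
  refine conductorExponent_quadraticTwist_of_emod_four_eq_three_two W v hv hd (fun n ↦ n = 4) ?_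
  intro V _ hV
  exact conductorExponent_quadraticTwist_negOne_eq_four_of_eq_two' V v hv (hV.trans hf)

/-- **S-an-60L (an All.lean §11 `conductorExponent_quadraticTwist_two_of_eq_three`), PROVED**: `f_v(W) = 3` at the place above `2`, `d ≡ 3 (mod 4)`
⟹ `f_v(W ⊗ d) = 4`. [cite: BarriosEtAl2025, Thm. 5.1, Table localdata-dodd rows III, I₁*, III*, II*, d ≡ 3 (mod 4)] -/
theorem conductorExponent_quadraticTwist_eq_four_of_eq_three_of_emod_four_eq_three :
    ∀ (W : WeierstrassCurve ℚ) [W.IsElliptic] (v : IsDedekindDomain.HeightOneSpectrum ℤ),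
      Rat.HeightOneSpectrum.natGenerator v = 2 → W.conductorExponent v = 3 → ∀ d : ℤ,
        d % 4 = 3 → (W.quadraticTwist (d : ℚ)).conductorExponent v = 4 := by
  intro W _ v hv hf d hd
  refine conductorExponent_quadraticTwist_of_emod_four_eq_three_two W v hv hd (fun n ↦ n = 4) ?_
  intro V _ hV
  exact conductorExponent_quadraticTwist_negOne_eq_four_of_eq_three' V v hv (hV.trans hf)

/-- **The `f₂ ∈ {2, 3}` rows together with the tree's `f₂ ≤ 1` theorem**: for `d ≡ 3 (mod 4)` and `f₂(W) ≤ 3`, `f₂(W ⊗ d) = 4`.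
[cite: BarriosEtAl2025, Thm. 5.1, Table localdata-dodd, all rows with f ≤ 3, d ≡ 3 (mod 4)] -/
theorem conductorExponent_quadraticTwist_eq_four_of_le_three_of_emod_four_eq_three (W : WeierstrassCurve ℚ) [W.IsElliptic]
    (v : HeightOneSpectrum ℤ) (hv : natGenerator v = 2) (hf : W.conductorExponent v ≤ 3) {d : ℤ} (hd : d % 4 = 3) :
    (W.quadraticTwist (d : ℚ)).conductorExponent v = 4 := by
  rcases Nat.lt_or_ge (W.conductorExponent v) 2 with h | h
  · exact (BarriosEtAl2025.conductorExponent_quadraticTwist_two_of_le_one_holds W v hv (by omega) d).1 hd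
  rcases Nat.lt_or_ge (W.conductorExponent v) 3 with h' | h'
  · exact conductorExponent_quadraticTwist_eq_four_of_eq_two_of_emod_four_eq_three W v hv (by omega) d hd
  · exact conductorExponent_quadraticTwist_eq_four_of_eq_three_of_emod_four_eq_three W v hv (by omega) d hd

end Summit.BirchSwinnertonDyer.BirchSwinnertonDyer.Theorems.ManinLocalTwoThree

end
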